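import Summits.NavierStokesRegularity.NavierStokesRegularity.Theorems.FilamentSkeletonRssKelvinGateSmoothing
import Summits.NavierStokesRegularity.NavierStokesRegularity.Theorems.FilamentSkeletonRssKelvinGateDefs
import Literature.Analysis.FluidPDE.BurgersVortex
import HarnessLib.Audit

/-!
# Line `column_gate_1A` for the crux `FilamentSkeletonRss.TransverseReduction1A` (stmt-NavierStokesRegularity-27414)

Second registered-shape line for the successor crux of `TransverseReductionRJ` (stmt-21221, now an ASIDE of the route;
the strategist payload names 21221, its mathematical content lives in `TransverseReduction1A`, stmt-27414).  Written by the
crux-strategist seat `cstrat-stmt-NavierStokesRegularity-21221-g2` (2026-08-28).  It is a SECTIONAL LYAPUNOV–SCHMIDT CUT of the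
monolithic stub S2′ `BorderedGate1A` of line `free_rate_gate_1A` (`Cruxes/TransverseReductionRJ/Lines/free_rate_gate_1A.lean`):
S1′ `Dressing1A`, S2′ `BorderedGate1A` (as a definition), S3′ `RateClosing1A` and the sorry-free glue `lineGlue1A` are kept
VERBATIM (same names, same texts), and S2′ is no longer a stub but the conclusion of

* S2a `WaistColumnGate1A` (L; KILL-FIRST; the judge's "stated invertibility lemma for the linearised core operator", in 3D):
  for the FROZEN WAIST MODEL — a straight Gaussian column of circulation `Rc ≥ R₀` and Gaussian parameter `κ − 3/2`
  along a unit axis `d`, sitting in the local linear frame flow `B` of a waist (`B d = κ d`, `3/2 + δ ≤ κ ≤ Λ`, normal trace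
  `3/2 − κ`, `‖B‖ ≤ Λ`) inside the rotating Leray frame (rate `|α| ≤ θ₀⁻¹`, axis `e₃`, NO tilt restriction) — the linearised
  profile operator `lerayLin α U⁰_col` (the SAME operator as in `GateSpec1A`, at the model base) obeys an a-priori bound with
  POLYNOMIAL LOSS `C·Rc^q` in sectionally weighted sup norms of the VORTICITY, for every `C³` divergence-free velocity
  perturbation of finite sectional size whose axial vorticity has ZERO SECTIONAL MASS AND FIRST MOMENTS at every station
  (the complement of the circulation and displacement modes, which belong to the reduced filament system, i.e. to clause 13-J).
  Constants uniform over the compact parameter box; `R₀, q, C` depend on `δ, Λ, θ₀` only.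
  Literature engine: the singular Burgers vortex (`μ > 1` there is `κ > 3/2` here, MMP 2019 = arXiv:1807.10341, Prop. 2:
  linear stability for ALL circulations but with a constant that "gets large when α → ∞"), Gallay–Maekawa 2011
  (arXiv:1002.2489: 3D Burgers column, uniform gap, `[∂₃, L] = −∂₃`), the tree's PROVED 2D sector
  `FilamentSkeletonRss.CoreLinearInvertibility` (R-uniform), and the circulation-quantitative 2D/3D pseudospectral
  technology (Li–Wei–Zhang 2020; arXiv:2512.15040 for the 3D Oseen column).  The R-polynomial dependence is the OPEN part.
* S2b `GateAssembly1A : WaistColumnGate1A → BorderedGate1A` (XL): patching — outer zone by the LANDED free resolvent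
  (`Theorems.KelvinGate.free_resolvent[_sharp]`), tube zones by the waist column gate transported along the slowly varying
  filaments (curvature `K/√Γ`, variation scale `√Γ`), drift stations swept downstream by `w ∂_τ`, the bordered reduced
  one-dimensional system for the sectional mass / displacement amplitudes inverted by clause 13-J (this is where the judge's
  key risk — Kelvin bending modes resonant with the frame rotation, axial wavenumber `~ Γ^{-1/2}` — lives, and ONLY there),
  Schur complement with `O(Γ^{-1/2})` commutators, tightness and rate-continuity bookkeeping of `GateSpec1A`.

Composition: `TransverseReduction1A_of := transverseReduction1A_iff.mpr (lineGlue1A stub_dressing1A (stub_gateAssembly1A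
stub_waistColumnGate1A) stub_rateClosing1A)` — the crux BY NAME from four `stub_*`.

HONEST FRAMING.  Bookkeeping for a HYPOTHETICAL filament-type rotating-self-similar blow-up route
(`route-NavierStokesRegularity-FilamentSkeletonRss`, refutation side: `closes … : ¬ NavierStokesRegularity`).  Nothing in this
file moves Navier–Stokes regularity.  S2a is independently provable or refutable (it is a statement about ONE explicit linear
operator); S2b inherits everything else of S2′ and is expected to be as hard as anything on the route.

`lean check`: rc 0, sorries = 4 (only `stub_*`); target `…Theses.FilamentSkeletonRss.TransverseReduction1A` BY NAME.
-/

set_option linter.dupNamespace false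

noncomputable section

namespace Summit.NavierStokesRegularity.NavierStokesRegularity.Cruxes.TransverseReduction1A.ColumnGate

open scoped BigOperators Topology Manifold Classical MeasureTheory ProbabilityTheory Matrix InnerProductSpace ComplexConjugate ContinuousMap ENNReal ContDiff
open Filter Set Function TopologicalSpace MeasureTheory
open Literature.NS
open Literature.Analysis.FluidPDE
open Summit.NavierStokesRegularity.NavierStokesRegularity.Theses.FilamentSkeletonRss
open Summit.NavierStokesRegularity.NavierStokesRegularity.Theorems.KelvinGate (lerayOp lerayLin XBound YBound LocClose)


/-! ## 1. The crux, cut at its arrows (texts VERBATIM from the route decl `TransverseReduction1A`, l.435 of the route file) -/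

/-- Defining hypothesis 1 (core-MATCHED regularised Biot–Savart field of a filament configuration `Z` with core areas `Aa`). -/
def DefU1 (N : ℕ) (Γ : ℝ) (γ : Fin N → ℝ) (Aa : Fin N → ℝ → ℝ) (u : (Fin N → ℝ → EuclideanSpace ℝ (Fin 3)) → EuclideanSpace ℝ (Fin 3) → EuclideanSpace ℝ (Fin 3)) : Prop :=
  ∀ Z y, u Z y = ∑ k, (Γ*γ k/(4*Real.pi))•∫ σ:ℝ, ((‖y-Z k σ‖^2+Real.exp (-(1+Real.eulerMascheroniConstant-Real.log 2))*Aa k σ)^(3/2:ℝ))⁻¹•cross (deriv (Z k) σ) (y-Z k σ)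

/-- Defining hypothesis 2 (frame field `v = u_X + ½y − α e₃×y`). -/
def DefV1 (N : ℕ) (α : ℝ) (X : Fin N → ℝ → EuclideanSpace ℝ (Fin 3)) (u : (Fin N → ℝ → EuclideanSpace ℝ (Fin 3)) → EuclideanSpace ℝ (Fin 3) → EuclideanSpace ℝ (Fin 3)) (v : EuclideanSpace ℝ (Fin 3) → EuclideanSpace ℝ (Fin 3)) : Prop :=
  ∀ y, v y = u X y+(1/2:ℝ)•y-α•cross (EuclideanSpace.single 2 1) y

/-- Defining hypothesis 3 (velocity gradient at the stagnation points). -/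
def DefA1 (N : ℕ) (X : Fin N → ℝ → EuclideanSpace ℝ (Fin 3)) (c : Fin N → ℝ) (v : EuclideanSpace ℝ (Fin 3) → EuclideanSpace ℝ (Fin 3)) (A : Fin N → (EuclideanSpace ℝ (Fin 3) →L[ℝ] EuclideanSpace ℝ (Fin 3))) : Prop :=
  ∀ j, A j = fderiv ℝ v (X j (c j))

/-- Defining hypothesis 4 (normal part of the frame velocity along a configuration: the filament-equilibrium map `T`). -/
def DefT1 (N : ℕ) (α : ℝ) (u : (Fin N → ℝ → EuclideanSpace ℝ (Fin 3)) → EuclideanSpace ℝ (Fin 3) → EuclideanSpace ℝ (Fin 3)) (T : (Fin N → ℝ → EuclideanSpace ℝ (Fin 3)) → Fin N → ℝ → EuclideanSpace ℝ (Fin 3)) : Prop :=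
  ∀ Z j τ, T Z j τ = (u Z (Z j τ)+(1/2:ℝ)•Z j τ-α•cross (EuclideanSpace.single 2 1) (Z j τ))-(⟪u Z (Z j τ)+(1/2:ℝ)•Z j τ-α•cross (EuclideanSpace.single 2 1) (Z j τ), deriv (Z j) τ⟫_ℝ/‖deriv (Z j) τ‖^2)•deriv (Z j) τ

/-- The `SkeletonJ1` clause block of the crux's hypothesis (clauses 1–13J + the core-area law), VERBATIM. -/
def Clauses1 (N : ℕ) (Γ δ ρ K Λ a b cnd Rw Rb cg θ₀ : ℝ) (γ : Fin N → ℝ) (α : ℝ) (X : Fin N → ℝ → EuclideanSpace ℝ (Fin 3)) (w : Fin N → ℝ → ℝ) (c : Fin N → ℝ) (m n : Fin N → EuclideanSpace ℝ (Fin 3)) (Aa : Fin N → ℝ → ℝ) (v : EuclideanSpace ℝ (Fin 3) → EuclideanSpace ℝ (Fin 3)) (A : Fin N → (EuclideanSpace ℝ (Fin 3) →L[ℝ] EuclideanSpace ℝ (Fin 3))) (T : (Fin N → ℝ → EuclideanSpace ℝ (Fin 3)) → Fin N → ℝ → EuclideanSpace ℝ (Fin 3)) : Prop :=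
  (α ≠ 0 ∧ (∀ j, γ j ≠ 0)∧(∀ j, ContDiff ℝ 2 (X j) ∧ Differentiable ℝ (w j)∧(∀ τ, ‖deriv (X j) τ‖ = 1)∧(∀ τ, ‖iteratedDeriv 2 (X j) τ‖*√Γ≤K) ∧ Tendsto (fun τ => ‖X j τ‖) (cocompact ℝ) atTop)∧(∀ j k, j ≠ k → ∀ τ σ, ρ*√Γ≤‖X j τ-X k σ‖)∧(∀ j τ σ, ρ*√Γ≤|τ-σ| → cg*ρ*√Γ≤‖X j τ-X j σ‖)∧(∀ j τ, cg*|τ-c j|≤Rw*√Γ+‖X j τ‖)∧(∀ j τ, w j τ = ⟪v (X j τ), deriv (X j) τ⟫_ℝ)∧(∀ j τ, ‖X j τ‖≤Rb*√(Γ*Real.log Γ) → v (X j τ) = w j τ•deriv (X j) τ)∧(∀ j, ‖X j (c j)‖≤Rw*√Γ)∧(∀ j, |⟪deriv (X j) (c j), EuclideanSpace.single 2 1⟫_ℝ|≤1-θ₀)∧(θ₀≤|α| ∧ |α|≤θ₀⁻¹ ∧ ∀ j, θ₀≤|γ j| ∧ |γ j|≤θ₀⁻¹)∧(∀ j, w j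 (c j) = 0 ∧ (∀ τ, w j τ = 0 → τ = c j) ∧ 3/2+δ≤deriv (w j) (c j) ∧ deriv (w j) (c j)≤Λ)∧(∀ j, Differentiable ℝ (Aa j) ∧ (∀ τ, 0 < Aa j τ) ∧ ∀ τ, w j τ*deriv (Aa j) τ = (3/2-deriv (w j) τ)*Aa j τ+4)∧(∀ j, Orthonormal ℝ ![deriv (X j) (c j), m j, n j] ∧ ⟪A j (m j), m j⟫_ℝ+⟪A j (n j), n j⟫_ℝ < 0 ∧ ⟪A j (n j), m j⟫_ℝ * ⟪A j (m j), n j⟫_ℝ < ⟪A j (m j), m j⟫_ℝ * ⟪A j (n j), n j⟫_ℝ)∧(∀ Y:Fin N → ℝ → EuclideanSpace ℝ (Fin 3), (∀ j, ContDiff ℝ 2 (Y j))→(∀ j τ, ⟪Y j τ, deriv (X j) τ⟫_ℝ = 0) → (∀ j τ, Rb*√(Γ*Real.log Γ) < ‖X j τ‖ → Y j τ = 0) → ∑ j, ⟪Y j (c j), cross (EuclideanSpace.single 2 1) (X j (c j))⟫_ℝ = 0 → (∀ j τ, ‖Y j τ‖+‖deriv (Y j) τ‖+‖iteratedDeriv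 2 (Y j) τ‖≤(1+|τ-c j|)^b) → ∀ L:ℝ, (∀ j τ, ‖deriv (fun s:ℝ => T (fun k σ => X k σ+s•Y k σ) j τ) 0‖≤L*(1+|τ-c j|)^a) → ∀ j τ, ‖Y j τ‖≤cnd*L*(1+|τ-c j|)^b))

/-- The crux's conclusion block for a candidate `(α₁, C₀, M, U, P)`, VERBATIM. -/
def Concl1 (N : ℕ) (Γ ρ η Rw : ℝ) (X : Fin N → ℝ → EuclideanSpace ℝ (Fin 3)) (u : (Fin N → ℝ → EuclideanSpace ℝ (Fin 3)) → EuclideanSpace ℝ (Fin 3) → EuclideanSpace ℝ (Fin 3)) (α₁ C₀ M : ℝ) (U : EuclideanSpace ℝ (Fin 3) → EuclideanSpace ℝ (Fin 3)) (P : EuclideanSpace ℝ (Fin 3) → ℝ) : Prop :=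
  α₁ ≠ 0 ∧ U ≠ 0 ∧ ContDiff ℝ (⊤:ℕ∞) U ∧ ContDiff ℝ (⊤:ℕ∞) P ∧ VectorCalculus.IsDivFree U∧(∀ y, α₁•(cross (EuclideanSpace.single 2 1) (U y)-fderiv ℝ U y (cross (EuclideanSpace.single 2 1) y))+(1/2:ℝ)•U y+(1/2:ℝ)•fderiv ℝ U y y-(Laplacian.laplacian U) y+fderiv ℝ U y (U y)+gradient P y = 0)∧(∀ y, ‖U y‖≤C₀/(1+‖y‖))∧(∀ y, |P y|≤M)∧(∀ y, ‖y‖≤Rw*√Γ → (∀ j τ, ρ*√Γ/4≤‖y-X j τ‖) → ‖U y-u X y‖≤η*√Γ)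

/-- The CUT FORM of the crux: hypotheses `DefU1 … Clauses1`, conclusion `Concl1` (an `abbrev`, so that the line's glue theorem
concludes THIS constant and only `TransverseReduction1A_of` below concludes the crux by name — skeleton A12 shape). -/
abbrev CutForm1A : Prop :=
    ∀ (N : ℕ) (δ ρ K Λ a b cnd η Rw Rb cg θ₀ : ℝ), 0 < N → 0 < δ → 0 < ρ → 0 ≤ a → 0 < η → 0 < Rw → 0 < Rb → 0 < cg → 0 < θ₀ → ∃ Γ₁ : ℝ, ∀ Γ : ℝ, Γ₁ ≤ Γ → ∀ (γ : Fin N → ℝ) (α : ℝ) (X : Fin N → ℝ → EuclideanSpace ℝ (Fin 3)) (w : Fin N → ℝ → ℝ) (c : Fin N → ℝ) (m n : Fin N → EuclideanSpace ℝ (Fin 3)) (Aa : Fin N → ℝ → ℝ) (u : (Fin N → ℝ → EuclideanSpace ℝ (Fin 3)) → EuclideanSpace ℝ (Fin 3) → EuclideanSpace ℝ (Fin 3)) (v : EuclideanSpace ℝ (Fin 3) → EuclideanSpace ℝ (Fin 3)) (A : Fin N → (EuclideanSpace ℝ (Fin 3) →L[ℝ] EuclideanSpace ℝ (Fin 3)))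 (T : (Fin N → ℝ → EuclideanSpace ℝ (Fin 3)) → Fin N → ℝ → EuclideanSpace ℝ (Fin 3)),
      DefU1 N Γ γ Aa u → DefV1 N α X u v → DefA1 N X c v A → DefT1 N α u T → Clauses1 N Γ δ ρ K Λ a b cnd Rw Rb cg θ₀ γ α X w c m n Aa v A T → ∃ (α₁ C₀ M : ℝ) (U : EuclideanSpace ℝ (Fin 3) → EuclideanSpace ℝ (Fin 3)) (P : EuclideanSpace ℝ (Fin 3) → ℝ), Concl1 N Γ ρ η Rw X u α₁ C₀ M U P

/-- CERTIFICATE that §1 is the crux: the route decl unfolds to the cut form by `Iff.rfl`. -/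
theorem transverseReduction1A_iff : TransverseReduction1A ↔ CutForm1A :=
  Iff.rfl


/-! ## 2. Vocabulary of the line (`lerayOp`, `lerayLin`, `XBound`, `YBound`, `LocClose` are the landed tools of
`Theorems.FilamentSkeletonRssKelvinGateDefs`, opened by name; the only NEW definitions are the rate column and three specs) -/

/-- The RATE COLUMN `𝓡U (y) = e₃ × U(y) − DU(y)[e₃ × y]` — the derivative of the profile operator in the rate:
`lerayOp α′ U y = lerayOp α U y + (α′ − α) • rateGen U y` (by `unfold lerayOp rateGen; module`). -/
def rateGen (U : EuclideanSpace ℝ (Fin 3) → EuclideanSpace ℝ (Fin 3)) (y : EuclideanSpace ℝ (Fin 3)) : EuclideanSpace ℝ (Fin 3) :=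
  cross (EuclideanSpace.single 2 1) (U y) - fderiv ℝ U y (cross (EuclideanSpace.single 2 1) y)

/-- **Spec of S1′ · DRESSED BASE of order `k` at ONE skeleton, with base rate `α⁰`.**  `(α⁰, U⁰, P⁰)`: rate within `θ₀/4` of the
skeleton's, `U⁰` smooth, divergence-free, of polynomial X-size `Cs·Γ⁴` together with its rate column, pressure bounded likewise,
NON-DEGENERATE (`|U⁰(y₀)| ≥ 1` somewhere), `η√Γ/2`-close to the skeleton field `u_X` off the `ρ√Γ/4`-tubes inside the waist ball,
and EXACT residual `E_(α⁰)(U⁰) + ∇P⁰` of Y-size `≤ Cr·Γ^(−k)`.  No multipliers, no modes. -/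
def BaseSpec1 (N : ℕ) (Γ ρ η Rw θ₀ : ℝ) (k : ℕ) (Cs Cr : ℝ) (α : ℝ) (X : Fin N → ℝ → EuclideanSpace ℝ (Fin 3)) (u : (Fin N → ℝ → EuclideanSpace ℝ (Fin 3)) → EuclideanSpace ℝ (Fin 3) → EuclideanSpace ℝ (Fin 3)) (α0 : ℝ) (U0 : EuclideanSpace ℝ (Fin 3) → EuclideanSpace ℝ (Fin 3)) (P0 : EuclideanSpace ℝ (Fin 3) → ℝ) : Prop :=
  |α0 - α| ≤ θ₀ / 4 ∧ ContDiff ℝ (⊤:ℕ∞) U0 ∧ ContDiff ℝ (⊤:ℕ∞) P0 ∧ VectorCalculus.IsDivFree U0 ∧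
  XBound U0 (Cs * Γ ^ 4) ∧ XBound (rateGen U0) (Cs * Γ ^ 4) ∧ (∀ y, |P0 y| ≤ Cs * Γ ^ 4) ∧ (∃ y₀, 1 ≤ ‖U0 y₀‖) ∧
  (∀ y, ‖y‖ ≤ Rw * √Γ → (∀ j τ, ρ * √Γ / 4 ≤ ‖y - X j τ‖) → ‖U0 y - u X y‖ ≤ η * √Γ / 2) ∧
  YBound (fun y => lerayOp α0 U0 y + gradient P0 y) (Cr * Γ ^ (-(k:ℝ)))

/-- **Spec of S2′ · BORDERED (free-rate) KELVIN GATE with polynomial loss.**  For every rate `α′` with `|α′ − α⁰| ≤ θ₀/4`: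
a RIGHT INVERSE `F ↦ (𝓚_α′ F, 𝓠_α′ F, 𝓫_α′ F)` of the bordered linearised profile operator,
`𝓛_(α′,U⁰)(𝓚F) + ∇(𝓠F) + (𝓫F)·𝓡U⁰ = F`, `div 𝓚F = 0`, with `X-size(𝓚F), |𝓠F|, |𝓫F| ≤ C₂ Γ^κ · Y-size(F)`;
(2) linear in `F`; (3) TIGHT, UNIFORMLY IN THE RATE (uniformly Y-bounded forcings small on a large ball give locally small velocity response and
small rate coefficient — the resolvent looks inward along the outward similarity transport, and the rotation cokernel functional is
`⟨y⟩⁻²`-localised); (4) locally continuous in the RATE for fixed data.  (3)+(4) are what make `β ↦ 𝓫_(α⁰+β)(G_β)` continuous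
through the Picard iterates of S3′ although the resolvent is only log-Lipschitz in the rate as a map Y → X. -/
def GateSpec1A (Γ κ C₂ θ₀ : ℝ) (α0 : ℝ) (U0 : EuclideanSpace ℝ (Fin 3) → EuclideanSpace ℝ (Fin 3)) (𝓚 : ℝ → (EuclideanSpace ℝ (Fin 3) → EuclideanSpace ℝ (Fin 3)) → EuclideanSpace ℝ (Fin 3) → EuclideanSpace ℝ (Fin 3)) (𝓠 : ℝ → (EuclideanSpace ℝ (Fin 3) → EuclideanSpace ℝ (Fin 3)) → EuclideanSpace ℝ (Fin 3) → ℝ) (𝓫 : ℝ → (EuclideanSpace ℝ (Fin 3) → EuclideanSpace ℝ (Fin 3)) → ℝ) : Prop :=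
  (∀ α' : ℝ, |α' - α0| ≤ θ₀ / 4 →
    (∀ (F : EuclideanSpace ℝ (Fin 3) → EuclideanSpace ℝ (Fin 3)) (R : ℝ), YBound F R →
        XBound (𝓚 α' F) (C₂ * Γ ^ κ * R) ∧ ContDiff ℝ 1 (𝓠 α' F) ∧ (∀ y, |𝓠 α' F y| ≤ C₂ * Γ ^ κ * R) ∧ |𝓫 α' F| ≤ C₂ * Γ ^ κ * R ∧
        VectorCalculus.IsDivFree (𝓚 α' F) ∧
        ∀ y, lerayLin α' U0 (𝓚 α' F) y + gradient (𝓠 α' F) y + 𝓫 α' F • rateGen U0 y = F y) ∧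
    (∀ (F G : EuclideanSpace ℝ (Fin 3) → EuclideanSpace ℝ (Fin 3)) (s : ℝ), (∃ R, YBound F R) → (∃ R, YBound G R) →
        (𝓚 α' (fun y => F y + s • G y) = fun y => 𝓚 α' F y + s • 𝓚 α' G y) ∧ 𝓫 α' (fun y => F y + s • G y) = 𝓫 α' F + s * 𝓫 α' G)) ∧
  (∀ R L ε : ℝ, 0 < ε → ∃ L' δ₀ : ℝ, 0 < δ₀ ∧ ∀ α' : ℝ, |α' - α0| ≤ θ₀ / 4 →
      ∀ F : EuclideanSpace ℝ (Fin 3) → EuclideanSpace ℝ (Fin 3), YBound F R → (∀ y, ‖y‖ ≤ L' → ‖F y‖ ≤ δ₀) →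
        (∀ y, ‖y‖ ≤ L → ‖𝓚 α' F y‖ ≤ ε ∧ ‖fderiv ℝ (𝓚 α' F) y‖ ≤ ε) ∧ |𝓫 α' F| ≤ ε) ∧
  (∀ α' : ℝ, |α' - α0| ≤ θ₀ / 4 → ∀ (F : EuclideanSpace ℝ (Fin 3) → EuclideanSpace ℝ (Fin 3)) (R L ε : ℝ), YBound F R → 0 < ε →
      ∃ δ' : ℝ, 0 < δ' ∧ ∀ α'' : ℝ, |α'' - α0| ≤ θ₀ / 4 → |α'' - α'| < δ' →
        LocClose (𝓚 α'' F) (𝓚 α' F) L ε ∧ |𝓫 α'' F - 𝓫 α' F| ≤ ε)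

/-- The crux's conclusion block with FINITE regularity (`U ∈ C²`, `P ∈ C¹`): what the fixed point of S3′ delivers before the
landed elliptic smoothing; otherwise VERBATIM `Concl1`. -/
def AlmostConcl1A (N : ℕ) (Γ ρ η Rw : ℝ) (X : Fin N → ℝ → EuclideanSpace ℝ (Fin 3)) (u : (Fin N → ℝ → EuclideanSpace ℝ (Fin 3)) → EuclideanSpace ℝ (Fin 3) → EuclideanSpace ℝ (Fin 3)) (α₁ C₀ M : ℝ) (U : EuclideanSpace ℝ (Fin 3) → EuclideanSpace ℝ (Fin 3)) (P : EuclideanSpace ℝ (Fin 3) → ℝ) : Prop :=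
  α₁ ≠ 0 ∧ U ≠ 0 ∧ ContDiff ℝ 2 U ∧ ContDiff ℝ 1 P ∧ VectorCalculus.IsDivFree U∧(∀ y, α₁•(cross (EuclideanSpace.single 2 1) (U y)-fderiv ℝ U y (cross (EuclideanSpace.single 2 1) y))+(1/2:ℝ)•U y+(1/2:ℝ)•fderiv ℝ U y y-(Laplacian.laplacian U) y+fderiv ℝ U y (U y)+gradient P y = 0)∧(∀ y, ‖U y‖≤C₀/(1+‖y‖))∧(∀ y, |P y|≤M)∧(∀ y, ‖y‖≤Rw*√Γ → (∀ j τ, ρ*√Γ/4≤‖y-X j τ‖) → ‖U y-u X y‖≤η*√Γ)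


/-! ## 3. The statements kept VERBATIM from line `free_rate_gate_1A` (S1′ `Dressing1A`, S2′ `BorderedGate1A`, S3′ `RateClosing1A`; same names and texts, so stub work on either line transfers) -/

/-- Statement of stub S1′ · `Dressing1A` (size XL; matched asymptotics with order-by-order rate selection): for every order `k` the
skeleton can be DRESSED into a base of order `k` (spec `BaseSpec1`), size constant `Cs` uniform in `k`. -/
def Dressing1A : Prop :=
  ∀ (N : ℕ) (δ ρ K Λ a b cnd η Rw Rb cg θ₀ : ℝ), 0 < N → 0 < δ → 0 < ρ → 0 ≤ a → 0 < η → 0 < Rw → 0 < Rb → 0 < cg → 0 < θ₀ →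
    ∃ Cs : ℝ, ∀ k : ℕ, ∃ Cr Γ₁ : ℝ, ∀ Γ : ℝ, Γ₁ ≤ Γ → ∀ (γ : Fin N → ℝ) (α : ℝ) (X : Fin N → ℝ → EuclideanSpace ℝ (Fin 3)) (w : Fin N → ℝ → ℝ) (c : Fin N → ℝ) (m n : Fin N → EuclideanSpace ℝ (Fin 3)) (Aa : Fin N → ℝ → ℝ) (u : (Fin N → ℝ → EuclideanSpace ℝ (Fin 3)) → EuclideanSpace ℝ (Fin 3) → EuclideanSpace ℝ (Fin 3)) (v : EuclideanSpace ℝ (Fin 3) → EuclideanSpace ℝ (Fin 3)) (A : Fin N → (EuclideanSpace ℝ (Fin 3) →L[ℝ] EuclideanSpace ℝ (Fin 3))) (T : (Fin N → ℝ → EuclideanSpace ℝ (Fin 3)) → Fin N → ℝ → EuclideanSpace ℝ (Fin 3)),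
      DefU1 N Γ γ Aa u → DefV1 N α X u v → DefA1 N X c v A → DefT1 N α u T → Clauses1 N Γ δ ρ K Λ a b cnd Rw Rb cg θ₀ γ α X w c m n Aa v A T →
      ∃ (α0 : ℝ) (U0 : EuclideanSpace ℝ (Fin 3) → EuclideanSpace ℝ (Fin 3)) (P0 : EuclideanSpace ℝ (Fin 3) → ℝ), BaseSpec1 N Γ ρ η Rw θ₀ k Cs Cr α X u α0 U0 P0

/-- Statement of stub S2′ · `BorderedGate1A` (size XL; KILL-FIRST, HARDEST): around EVERY dressed base of any sufficiently high
order `k ≥ k₀` and size `Cs` there is a bordered free-rate gate (spec `GateSpec1A`) with exponent `κ` and constant `C₂` depending on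
the box constants and `Cs` only — not on `Γ`, the skeleton, the base, or `k`. -/
def BorderedGate1A : Prop :=
  ∀ (N : ℕ) (δ ρ K Λ a b cnd η Rw Rb cg θ₀ : ℝ), 0 < N → 0 < δ → 0 < ρ → 0 ≤ a → 0 < η → 0 < Rw → 0 < Rb → 0 < cg → 0 < θ₀ →
    ∀ Cs : ℝ, ∃ κ C₂ : ℝ, ∃ k₀ : ℕ, ∀ k : ℕ, k₀ ≤ k → 1 ≤ k → ∀ Cr : ℝ, ∃ Γ₁ : ℝ, ∀ Γ : ℝ, Γ₁ ≤ Γ → ∀ (γ : Fin N → ℝ) (α : ℝ) (X : Fin N → ℝ → EuclideanSpace ℝ (Fin 3)) (w : Fin N → ℝ → ℝ) (c : Fin N → ℝ) (m n : Fin N → EuclideanSpace ℝ (Fin 3)) (Aa : Fin N → ℝ → ℝ) (u : (Fin N → ℝ → EuclideanSpace ℝ (Fin 3)) → EuclideanSpace ℝ (Fin 3) → EuclideanSpace ℝ (Fin 3)) (v : EuclideanSpace ℝ (Fin 3) → EuclideanSpace ℝ (Fin 3)) (A : Fin N → (EuclideanSpace ℝ (Fin 3) →L[ℝ] EuclideanSpace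 ℝ (Fin 3))) (T : (Fin N → ℝ → EuclideanSpace ℝ (Fin 3)) → Fin N → ℝ → EuclideanSpace ℝ (Fin 3)),
      DefU1 N Γ γ Aa u → DefV1 N α X u v → DefA1 N X c v A → DefT1 N α u T → Clauses1 N Γ δ ρ K Λ a b cnd Rw Rb cg θ₀ γ α X w c m n Aa v A T →
      ∀ (α0 : ℝ) (U0 : EuclideanSpace ℝ (Fin 3) → EuclideanSpace ℝ (Fin 3)) (P0 : EuclideanSpace ℝ (Fin 3) → ℝ), BaseSpec1 N Γ ρ η Rw θ₀ k Cs Cr α X u α0 U0 P0 →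
      ∃ (𝓚 : ℝ → (EuclideanSpace ℝ (Fin 3) → EuclideanSpace ℝ (Fin 3)) → EuclideanSpace ℝ (Fin 3) → EuclideanSpace ℝ (Fin 3)) (𝓠 : ℝ → (EuclideanSpace ℝ (Fin 3) → EuclideanSpace ℝ (Fin 3)) → EuclideanSpace ℝ (Fin 3) → ℝ) (𝓫 : ℝ → (EuclideanSpace ℝ (Fin 3) → EuclideanSpace ℝ (Fin 3)) → ℝ), GateSpec1A Γ κ C₂ θ₀ α0 U0 𝓚 𝓠 𝓫

/-- Statement of stub S3′ · `RateClosing1A` (size L; frozen-rate contraction + one-dimensional rate selection + bookkeeping): given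
the gate's `κ, C₂`, the size `Cs` and ANY threshold `k₀`, SOME dressing order `k ≥ k₀` suffices: for every dressed base of that order and
every bordered gate around it, for `Γ ≥ Γ₁` there are `β` with `|β| ≤ θ₀/4` and a fixed point `G_β = −r − D(𝓚_(α⁰+β) G_β)[𝓚_(α⁰+β) G_β]`
with `β = 𝓫_(α⁰+β) G_β`, whence `α₁ = α⁰ + β ≠ 0`, `U = U⁰ + 𝓚G`, `P = P⁰ + 𝓠G` satisfy the crux's conclusion with `C²/C¹` regularity. -/
def RateClosing1A : Prop :=
  ∀ (N : ℕ) (δ ρ K Λ a b cnd η Rw Rb cg θ₀ : ℝ), 0 < N → 0 < δ → 0 < ρ → 0 ≤ a → 0 < η → 0 < Rw → 0 < Rb → 0 < cg → 0 < θ₀ →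
    ∀ Cs κ C₂ : ℝ, ∀ k₀ : ℕ, ∃ k : ℕ, k₀ ≤ k ∧ 1 ≤ k ∧ ∀ Cr : ℝ, ∃ Γ₁ : ℝ, ∀ Γ : ℝ, Γ₁ ≤ Γ → ∀ (γ : Fin N → ℝ) (α : ℝ) (X : Fin N → ℝ → EuclideanSpace ℝ (Fin 3)) (w : Fin N → ℝ → ℝ) (c : Fin N → ℝ) (m n : Fin N → EuclideanSpace ℝ (Fin 3)) (Aa : Fin N → ℝ → ℝ) (u : (Fin N → ℝ → EuclideanSpace ℝ (Fin 3)) → EuclideanSpace ℝ (Fin 3) → EuclideanSpace ℝ (Fin 3)) (v : EuclideanSpace ℝ (Fin 3) → EuclideanSpace ℝ (Fin 3)) (A : Fin N → (EuclideanSpace ℝ (Fin 3) →L[ℝ] EuclideanSpace ℝ (Fin 3))) (T : (Fin N → ℝ → EuclideanSpace ℝ (Fin 3)) → Fin N → ℝ → EuclideanSpace ℝ (Fin 3)),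
      DefU1 N Γ γ Aa u → DefV1 N α X u v → DefA1 N X c v A → DefT1 N α u T → Clauses1 N Γ δ ρ K Λ a b cnd Rw Rb cg θ₀ γ α X w c m n Aa v A T →
      ∀ (α0 : ℝ) (U0 : EuclideanSpace ℝ (Fin 3) → EuclideanSpace ℝ (Fin 3)) (P0 : EuclideanSpace ℝ (Fin 3) → ℝ), BaseSpec1 N Γ ρ η Rw θ₀ k Cs Cr α X u α0 U0 P0 →
      ∀ (𝓚 : ℝ → (EuclideanSpace ℝ (Fin 3) → EuclideanSpace ℝ (Fin 3)) → EuclideanSpace ℝ (Fin 3) → EuclideanSpace ℝ (Fin 3)) (𝓠 : ℝ → (EuclideanSpace ℝ (Fin 3) → EuclideanSpace ℝ (Fin 3)) → EuclideanSpace ℝ (Fin 3) → ℝ) (𝓫 : ℝ → (EuclideanSpace ℝ (Fin 3) → EuclideanSpace ℝ (Fin 3)) → ℝ), GateSpec1A Γ κ C₂ θ₀ α0 U0 𝓚 𝓠 𝓫 →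
      ∃ (α₁ C₀ M : ℝ) (U : EuclideanSpace ℝ (Fin 3) → EuclideanSpace ℝ (Fin 3)) (P : EuclideanSpace ℝ (Fin 3) → ℝ), AlmostConcl1A N Γ ρ η Rw X u α₁ C₀ M U P



/-! ## 4. NEW in this line: the frozen WAIST COLUMN MODEL and the sectional gate S2a -/

/-- A point of the cross-section at axial station `τ` in the orthonormal frame `(d; m, n)`: `τ d + ξ₀ m + ξ₁ n`. -/
def secPt (d m n : EuclideanSpace ℝ (Fin 3)) (τ : ℝ) (ξ : EuclideanSpace ℝ (Fin 2)) : EuclideanSpace ℝ (Fin 3) :=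
  τ • d + ξ 0 • m + ξ 1 • n

/-- The sectional weight `⟨ξ⟩² = 1 + |y|² − ⟨y, d⟩²` (`= 1 + ξ₀² + ξ₁²` at `y = secPt d m n τ ξ`): polynomial, NOT Gaussian, so
that cut-offs at sectional radius `Γ^ε` cost polynomially in the patching S2b. -/
def secWt (d y : EuclideanSpace ℝ (Fin 3)) : ℝ :=
  1 + ‖y‖ ^ 2 - ⟪y, d⟫_ℝ ^ 2

/-- The GAUSSIAN COLUMN SWIRL of circulation `Rc` and Gaussian parameter `gam` about the unit axis `d` (viscosity 1):
`(gam·Rc/8π) φ(gam r²/4) · d × y`, `r² = |y|² − ⟨y,d⟩²`, `φ = burgersPhi` — verbatim `burgersVortexSwirl gam 1 Rc` for `d = e₃`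
(Gallay–Maekawa 2016 (1.21)–(1.22)); its vorticity is the Gaussian `(gam Rc/4π) e^{−gam r²/4} d`. -/
def colSwirl (gam Rc : ℝ) (d y : EuclideanSpace ℝ (Fin 3)) : EuclideanSpace ℝ (Fin 3) :=
  (gam * Rc / (8 * Real.pi) * burgersPhi (gam * (‖y‖ ^ 2 - ⟪y, d⟫_ℝ ^ 2) / 4)) • cross d y

/-- The FROZEN WAIST MODEL base field in the rotating Leray frame: `U⁰_col(y) = B y − ½ y + α e₃×y + colSwirl`, where `B` is the
gradient of the FRAME field `v = U + ½y − α e₃×y` at the waist (so `B − ½ + αJ` is the gradient of `U` itself): the local linear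
flow of the waist plus the straight Gaussian column.  With `B d = κ d` and normal trace `3/2 − κ = −gam` the column
`e^{−gam r²/4}` is the sectional steady state (core area `4/(κ − 3/2)`, the skeleton's core-area law at `w = 0`). -/
def colBase (B : EuclideanSpace ℝ (Fin 3) →L[ℝ] EuclideanSpace ℝ (Fin 3)) (α gam Rc : ℝ) (d y : EuclideanSpace ℝ (Fin 3)) :
    EuclideanSpace ℝ (Fin 3) :=
  B y - (1/2:ℝ) • y + α • cross (EuclideanSpace.single 2 1) y + colSwirl gam Rc d y

/-- The VORTICITY of the linearised profile operator at the column model acting on a velocity perturbation `W`: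
`curl (lerayLin α U⁰_col W)` (the pressure gradient drops out under `curl`; for `W ∈ C³` all derivatives are classical). -/
def colForceVort (B : EuclideanSpace ℝ (Fin 3) →L[ℝ] EuclideanSpace ℝ (Fin 3)) (α gam Rc : ℝ) (d : EuclideanSpace ℝ (Fin 3))
    (W : EuclideanSpace ℝ (Fin 3) → EuclideanSpace ℝ (Fin 3)) (y : EuclideanSpace ℝ (Fin 3)) : EuclideanSpace ℝ (Fin 3) :=
  curl (fun z => lerayLin α (colBase B α gam Rc d) W z) y

/-- **Statement of stub S2a · `WaistColumnGate1A` (size L; KILL-FIRST).**  SECTIONAL A-PRIORI BOUND WITH POLYNOMIAL LOSS for the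
frozen waist column, uniformly over the parameter box.  For all `δ, Λ, θ₀ > 0` there are `R₀, q, C` such that for every circulation
`Rc ≥ R₀`, every orthonormal frame `(d; m, n)`, every `κ ∈ [3/2 + δ, Λ]`, every rate `|α| ≤ θ₀⁻¹`, every frame gradient `B` with
`B d = κ d`, `⟨Bm,m⟩ + ⟨Bn,n⟩ = 3/2 − κ`, `‖B‖ ≤ Λ`, and every velocity perturbation `W ∈ C³`, `div W = 0`, of finite sectional size
(`⟨ξ⟩²|W|` and `⟨ξ⟩⁴|curl W|` bounded — qualitative membership, any bound), whose axial vorticity `⟨curl W, d⟩` has zero sectional mass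
and zero sectional first moments at EVERY station `τ`:
`⟨ξ⟩⁴ |curl (lerayLin α U⁰_col W)| ≤ 1` everywhere ⟹ `⟨ξ⟩⁴ |curl W| ≤ C Rc^q` everywhere.
(Gaussian parameter `gam = κ − 3/2 ≥ δ`; the weight `⟨ξ⟩⁴` makes the sectional moments absolutely convergent, so no junk integral;
mass and displacement modes are EXCLUDED here and bordered in S2b; the tilt of `d` against `e₃` is unrestricted on purpose.) -/
def WaistColumnGate1A : Prop :=
  ∀ δ Λ θ₀ : ℝ, 0 < δ → 0 < Λ → 0 < θ₀ → ∃ R₀ q C : ℝ, 0 < C ∧ ∀ Rc : ℝ, R₀ ≤ Rc →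
    ∀ (d m n : EuclideanSpace ℝ (Fin 3)) (κ α : ℝ) (B : EuclideanSpace ℝ (Fin 3) →L[ℝ] EuclideanSpace ℝ (Fin 3)),
      Orthonormal ℝ ![d, m, n] → 3/2 + δ ≤ κ → κ ≤ Λ → |α| ≤ θ₀⁻¹ →
      B d = κ • d → ⟪B m, m⟫_ℝ + ⟪B n, n⟫_ℝ = 3/2 - κ → ‖B‖ ≤ Λ →
      ∀ W : EuclideanSpace ℝ (Fin 3) → EuclideanSpace ℝ (Fin 3), ContDiff ℝ 3 W → VectorCalculus.IsDivFree W →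
        (∃ A : ℝ, ∀ y, secWt d y * ‖W y‖ ≤ A ∧ secWt d y ^ 2 * ‖curl W y‖ ≤ A) →
        (∀ τ : ℝ, (∫ ξ : EuclideanSpace ℝ (Fin 2), ⟪curl W (secPt d m n τ ξ), d⟫_ℝ = 0) ∧
          (∫ ξ : EuclideanSpace ℝ (Fin 2), ξ 0 * ⟪curl W (secPt d m n τ ξ), d⟫_ℝ = 0) ∧
          (∫ ξ : EuclideanSpace ℝ (Fin 2), ξ 1 * ⟪curl W (secPt d m n τ ξ), d⟫_ℝ = 0)) →
        (∀ y, secWt d y ^ 2 * ‖colForceVort B α (κ - 3/2) Rc d W y‖ ≤ 1) →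
        ∀ y, secWt d y ^ 2 * ‖curl W y‖ ≤ C * Rc ^ q

/-- **Statement of stub S2b · `GateAssembly1A` (size XL).**  PATCHING: the sectional waist gate S2a, the landed free resolvent, the
downstream sweep at drift stations and clause 13-J for the bordered one-dimensional mass/displacement system assemble into the
bordered free-rate gate `GateSpec1A` around every dressed base — i.e. S2′ `BorderedGate1A` of line `free_rate_gate_1A`. -/
def GateAssembly1A : Prop :=
  WaistColumnGate1A → BorderedGate1A


/-! ## 5. Registered stubs and the kernel-checked composition -/

/-- **Stub S1′** (`Dressing1A`) — verbatim the stub of line `free_rate_gate_1A`. -/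
theorem stub_dressing1A : Dressing1A := by
  sorry

/-- **Stub S2a** (`WaistColumnGate1A`) — KILL-FIRST: one explicit linear operator; prove it or refute it. -/
theorem stub_waistColumnGate1A : WaistColumnGate1A := by
  sorry

/-- **Stub S2b** (`GateAssembly1A`) — patching: sectional gate ⟹ bordered gate. -/
theorem stub_gateAssembly1A : GateAssembly1A := by
  sorry

/-- **Stub S3′** (`RateClosing1A`) — verbatim the stub of line `free_rate_gate_1A`. -/
theorem stub_rateClosing1A : RateClosing1A := by
  sorry

/-- **Glue (pure logic + the LANDED smoothing ladder, no sorry)** — verbatim `free_rate_gate_1A.lineGlue1A`. -/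
theorem lineGlue1A (h1 : Dressing1A) (h2 : BorderedGate1A) (h3 : RateClosing1A) : CutForm1A := by
  intro N δ ρ K Λ a b cnd η Rw Rb cg θ₀ hN hδ hρ ha hη hRw hRb hcg hθ₀
  obtain ⟨Cs, hS1⟩ := h1 N δ ρ K Λ a b cnd η Rw Rb cg θ₀ hN hδ hρ ha hη hRw hRb hcg hθ₀
  obtain ⟨κ, C₂, k₀, hS2⟩ := h2 N δ ρ K Λ a b cnd η Rw Rb cg θ₀ hN hδ hρ ha hη hRw hRb hcg hθ₀ Cs
  obtain ⟨k, hk₀, hk, hS3⟩ := h3 N δ ρ K Λ a b cnd η Rw Rb cg θ₀ hN hδ hρ ha hη hRw hRb hcg hθ₀ Cs κ C₂ k₀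
  obtain ⟨Cr, Γa, hS1'⟩ := hS1 k
  obtain ⟨Γb, hS2'⟩ := hS2 k hk₀ hk Cr
  obtain ⟨Γc, hS3'⟩ := hS3 Cr
  refine ⟨max Γa (max Γb Γc), ?_⟩
  intro Γ hΓ γ α X w c m n Aa u v A T hu hv hA hT hcl
  have hΓa : Γa ≤ Γ := le_trans (le_max_left _ _) hΓ
  have hΓb : Γb ≤ Γ := le_trans (le_trans (le_max_left _ _) (le_max_right _ _)) hΓ
  have hΓc : Γc ≤ Γ := le_trans (le_trans (le_max_right _ _) (le_max_right _ _)) hΓ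
  obtain ⟨α0, U0, P0, hbase⟩ := hS1' Γ hΓa γ α X w c m n Aa u v A T hu hv hA hT hcl
  obtain ⟨𝓚, 𝓠, 𝓫, hgate⟩ := hS2' Γ hΓb γ α X w c m n Aa u v A T hu hv hA hT hcl α0 U0 P0 hbase
  obtain ⟨α₁, C₀, M, U, P, hU⟩ := hS3' Γ hΓc γ α X w c m n Aa u v A T hu hv hA hT hcl α0 U0 P0 hbase 𝓚 𝓠 𝓫 hgate
  obtain ⟨hα₁, hne, hU2, hP1, hdiv, heq, hdec, hPM, hwin⟩ := hU
  have hF : ContDiff ℝ ∞ (fun _ : EuclideanSpace ℝ (Fin 3) => (0 : EuclideanSpace ℝ (Fin 3))) := contDiff_const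
  have hUs : ContDiff ℝ ∞ U :=
    Theorems.KelvinGate.Smoothing.contDiff_velocity_infty (F := fun _ => 0) hU2 hdiv hP1 hF heq
  have hPs : ContDiff ℝ ∞ P :=
    Theorems.KelvinGate.Smoothing.contDiff_pressure_infty (F := fun _ => 0) hU2 hdiv hP1 hF heq
  exact ⟨α₁, C₀, M, U, P, hα₁, hne, hUs, hPs, hdiv, heq, hdec, hPM, hwin⟩

/-- **The skeleton (A12 shape): the crux BY NAME from the four registered stubs** — S2′ is obtained as
`stub_gateAssembly1A stub_waistColumnGate1A`. -/
theorem TransverseReduction1A_of : TransverseReduction1A :=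
  transverseReduction1A_iff.mpr (lineGlue1A stub_dressing1A (stub_gateAssembly1A stub_waistColumnGate1A) stub_rateClosing1A)

/-! ## 6. Sorry-free sanity lemmas about the model (not stubs) -/

/-- The column swirl along `e₃` IS the Literature Burgers swirl with viscosity 1. -/
theorem colSwirl_e3 (gam Rc : ℝ) (y : EuclideanSpace ℝ (Fin 3)) :
    colSwirl gam Rc (EuclideanSpace.single 2 1) y = burgersVortexSwirl gam 1 Rc y := by
  unfold colSwirl burgersVortexSwirl
  have h1 : ⟪y, EuclideanSpace.single (2 : Fin 3) (1 : ℝ)⟫_ℝ = y 2 := by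
    simp [EuclideanSpace.inner_single_right]
  have h2 : ‖y‖ ^ 2 = y 0 ^ 2 + y 1 ^ 2 + y 2 ^ 2 := by
    rw [EuclideanSpace.norm_eq, Real.sq_sqrt (Finset.sum_nonneg fun i _ => sq_nonneg _)]
    simp [Fin.sum_univ_three, Real.norm_eq_abs, sq_abs]
  have h3 : cross (EuclideanSpace.single (2 : Fin 3) (1 : ℝ)) y = rotGen y := by
    ext i
    fin_cases i <;> simp [cross, crossProduct, rotGen, Matrix.cons_val_zero, Matrix.cons_val_one]
  rw [h1, h2, h3]
  congr 1
  ring_nf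

/-- The sectional weight is at least 1 for a unit axis (Cauchy–Schwarz), so the weighted bounds of S2a are not vacuous by sign. -/
theorem one_le_secWt {d : EuclideanSpace ℝ (Fin 3)} (hd : ‖d‖ = 1) (y : EuclideanSpace ℝ (Fin 3)) : 1 ≤ secWt d y := by
  unfold secWt
  have h := abs_real_inner_le_norm y d
  rw [hd, mul_one] at h
  have h' : ⟪y, d⟫_ℝ ^ 2 ≤ ‖y‖ ^ 2 := by
    calc ⟪y, d⟫_ℝ ^ 2 = |⟪y, d⟫_ℝ| ^ 2 := (sq_abs _).symm
      _ ≤ ‖y‖ ^ 2 := pow_le_pow_left₀ (abs_nonneg _) h 2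
  linarith

end Summit.NavierStokesRegularity.NavierStokesRegularity.Cruxes.TransverseReduction1A.ColumnGate
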